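import Summits.QuantumAdvantage.QuantumAdvantage.Theorems.CubicForrelationNearExactIsExactCubicFormCellL2
import Summits.QuantumAdvantage.QuantumAdvantage.Theorems.CubicForrelationNearExactIsExactCubicFormSymplectic
import Summits.QuantumAdvantage.QuantumAdvantage.Theorems.CubicForrelationNearExactIsExactCubicFormDicksonExact
import Summits.QuantumAdvantage.QuantumAdvantage.Theorems.CubicForrelationNearExactIsExactCubicFormRank
import Summits.QuantumAdvantage.QuantumAdvantage.Theorems.CubicForrelationNearExactIsExactCubicFormRadical
import Summits.QuantumAdvantage.QuantumAdvantage.Theorems.CubicForrelationNearExactIsExactCubicFormBalanced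
import Summits.QuantumAdvantage.QuantumAdvantage.Theorems.CubicForrelationNearExactIsExactCubicFormR4TCells

/-!
# Crux `CubicForrelation.NearExactIsExact` (stmt-QuantumAdvantage-14043) — E1280-even, R4 branch, descendant `0` (`HZ`): QUADRATIC CELLS
  on `7` bits — derivatives along the radical, the weight levels `0 / 32 / 48 / 64`, and the size of the radical

Certificate seat `b2b-cforr-cert` (gen 43).  HONEST FRAMING: kernel-checked cell lemmas (standard axioms) for the descendant `t̄₇ = 0` of
…CubicFormR4PartnerDispatch (`HZ`), where every cell `f_v = κ(0,v,·)` is a quadratic on `𝔽₂⁷` (R4-PARTNER §3–4, menu (M0)).  For `q` with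
vanishing third differences and base-point free form `B`:
* `tq0_form_row_zero`: `B(U, e_m) = 0` for all `m` ⇒ `B(U, ·) = 0`;  `tq0_deriv_const`: then `D_U q` is constant.
* `tq0_weight32`: `q ≡ 0` or `#q ≥ 32` (Dickson);  `tq0_weight64_of_form_zero`: `B ≡ 0` and `q ≢ 0` ⇒ `#q ≥ 64`.
* `tq0_rad32`: if `B ≠ 0` and `#q < 48` then the radical of `B` has exactly `32` elements (rank `2`).
Nothing about `θ₁₂`; NOT summit progress.

References: this seat lineage (g37 R4-PARTNER §2 (M0), §3); L. E. Dickson (1901); MacWilliams–Sloane Ch. 15 §2.  Axioms: the standard three.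
-/

set_option linter.dupNamespace false -- D-0017: single-problem summit ⇒ `QuantumAdvantage.QuantumAdvantage` by design

namespace Summit.QuantumAdvantage.QuantumAdvantage.Theorems.CubicForrelation.NearExactIsExact

open Finset
open Literature.Computability.QuantumComplexity
open Literature.Computability.QuantumComplexity.BuzetChailloux (bxor zeroVec bxor_comm bxor_self bxor_zeroVec zeroVec_bxor
  bxor_bxor_cancel_left)

section Quad

variable {n : ℕ} (q : (Fin n → Bool) → Bool)
  (h3 : ∀ u v w x : Fin n → Bool, (((q x ^^ q (bxor x w)) ^^ (q (bxor x v) ^^ q (bxor (bxor x v) w))) ^^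
      ((q (bxor x u) ^^ q (bxor (bxor x u) w)) ^^ (q (bxor (bxor x u) v) ^^ q (bxor (bxor (bxor x u) v) w)))) = false)
include h3

/-- **A row of the form vanishing on the unit vectors vanishes.**  For `q` with vanishing third differences: if the second differences
`Δ_{U,e_m} q(0)` vanish for every coordinate `m`, then `Δ_{U,y} q(0) = 0` for every `y`. [folklore] -/
theorem tq0_form_row_zero (U : Fin n → Bool)
    (hz : ∀ m : Fin n, ((q zeroVec ^^ q (fun l => decide (l = m))) ^^ (q U ^^ q (bxor U (fun l => decide (l = m))))) = false) :
    ∀ y : Fin n → Bool, ((q zeroVec ^^ q y) ^^ (q U ^^ q (bxor U y))) = false := by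
  -- the base-point free form `B v w = Δ_{v,w} q (0)`
  have hB' : ∀ v w x, ((q x ^^ q (bxor x w)) ^^ (q (bxor x v) ^^ q (bxor (bxor x v) w))) =
      ((q zeroVec ^^ q (bxor zeroVec w)) ^^ (q (bxor zeroVec v) ^^ q (bxor (bxor zeroVec v) w))) :=
    fun v w x => tl2_second_const q h3 v w x
  obtain ⟨hsymm, hadd, -, -⟩ := tcb_form_basic q
    (fun v w => (q zeroVec ^^ q (bxor zeroVec w)) ^^ (q (bxor zeroVec v) ^^ q (bxor (bxor zeroVec v) w))) hB'
  -- `y ↦ B U y` is invariant under unit translations, hence constant `= B U 0 = 0`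
  have hG := tq1_const_of_units
    (fun y => (q zeroVec ^^ q (bxor zeroVec y)) ^^ (q (bxor zeroVec U) ^^ q (bxor (bxor zeroVec U) y))) (fun x j => by
      show ((q zeroVec ^^ q (bxor zeroVec (bxor x (fun l => decide (l = j))))) ^^
          (q (bxor zeroVec U) ^^ q (bxor (bxor zeroVec U) (bxor x (fun l => decide (l = j)))))) =
        ((q zeroVec ^^ q (bxor zeroVec x)) ^^ (q (bxor zeroVec U) ^^ q (bxor (bxor zeroVec U) x)))
      rw [hsymm U (bxor x (fun l => decide (l = j))), hadd x (fun l => decide (l = j)) U, hsymm x U,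
        hsymm (fun l => decide (l = j)) U]
      have e := hz j
      simp only [zeroVec_bxor] at e ⊢
      rw [e, Bool.xor_false])
  intro y
  have e := hG y
  simp only [zeroVec_bxor, bxor_zeroVec] at e
  rw [e]
  cases q zeroVec <;> cases q U <;> rfl

/-- **A derivative with vanishing second differences is constant**: under the hypotheses of `tq0_form_row_zero`,
`q(s ⊕ U) = q(s) ⊕ q(0) ⊕ q(U)`. [folklore] -/
theorem tq0_deriv_const (U : Fin n → Bool)
    (hz : ∀ m : Fin n, ((q zeroVec ^^ q (fun l => decide (l = m))) ^^ (q U ^^ q (bxor U (fun l => decide (l = m))))) = false) :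
    ∀ s, q (bxor s U) = ((q s ^^ q zeroVec) ^^ q U) := by
  intro s
  have e := tq0_form_row_zero q h3 U hz s
  rw [bxor_comm] at e
  revert e
  cases q zeroVec <;> cases q s <;> cases q U <;> cases q (bxor s U) <;> decide

end Quad

/-- **Weight levels of a quadratic on `7` bits: zero or at least `32`.** [cite: MacWilliamsSloane1977, Ch. 15 §2] -/
theorem tq0_weight32 (q : (Fin 7 → Bool) → Bool)
    (h3 : ∀ u v w x : Fin 7 → Bool, (((q x ^^ q (bxor x w)) ^^ (q (bxor x v) ^^ q (bxor (bxor x v) w))) ^^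
      ((q (bxor x u) ^^ q (bxor (bxor x u) w)) ^^ (q (bxor (bxor x u) v) ^^ q (bxor (bxor (bxor x u) v) w)))) = false) :
    (∀ s, q s = false) ∨ 32 ≤ #(univ.filter fun s : Fin 7 → Bool => q s = true) := by
  classical
  set B : (Fin 7 → Bool) → (Fin 7 → Bool) → Bool :=
    fun v w => (q zeroVec ^^ q (bxor zeroVec w)) ^^ (q (bxor zeroVec v) ^^ q (bxor (bxor zeroVec v) w)) with hBdef
  have hB' : ∀ v w y, ((q y ^^ q (bxor y w)) ^^ (q (bxor y v) ^^ q (bxor (bxor y v) w))) = B v w :=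
    fun v w y => tl2_second_const q h3 v w y
  obtain ⟨hsymm, hadd, halt, htr⟩ := tcb_form_basic q B hB'
  obtain ⟨h, b, c, hbc, hbc', hbb, hcc, hmax⟩ := tcs_frame_exists B hsymm halt
  obtain ⟨hle, htri⟩ := tce_dickson_exact q B hB' h b c hbc hbc' hbb hmax
  rcases Nat.eq_zero_or_pos h with h0 | hpos
  · -- form zero: `q ⊕ q 0` is additive, so `q` is constant, or balanced (`64`)
    subst h0
    have hB0 : ∀ x y, B x y = false := tce_form_zero_of_frame_zero B b c hmax
    by_cases hc : ∃ t, q t ≠ q zeroVec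
    · obtain ⟨t, ht⟩ := hc
      have hbal := (tcb_balanced_iff q B hB').mpr ⟨t, fun y => hB0 t y, ht⟩
      right
      norm_num at hbal
      omega
    · push Not at hc
      cases h0v : q zeroVec
      · left; intro s; rw [hc s, h0v]
      · right
        have hall : (univ.filter fun s : Fin 7 → Bool => q s = true) = univ := by
          apply eq_univ_of_forall; intro s; rw [mem_filter]; exact ⟨mem_univ _, by rw [hc s, h0v]⟩
        rw [hall, card_univ, Fintype.card_fun, Fintype.card_bool, Fintype.card_fin]
        norm_num
  · right
    have hpow : 2 ^ (7 - h) ≤ 64 := by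
      calc 2 ^ (7 - h) ≤ 2 ^ 6 := Nat.pow_le_pow_right (by norm_num) (by omega)
        _ = 64 := by norm_num
    generalize hX : 2 ^ (7 - h) = X at htri hpow
    omega

/-- **An affine cell is zero or weighs at least `64`.**  If all second differences of `q` (at `0`, along unit vectors) vanish and
`q ≢ 0`, then `#q ≥ 64`. [folklore] -/
theorem tq0_weight64_of_form_zero (q : (Fin 7 → Bool) → Bool)
    (h3 : ∀ u v w x : Fin 7 → Bool, (((q x ^^ q (bxor x w)) ^^ (q (bxor x v) ^^ q (bxor (bxor x v) w))) ^^
      ((q (bxor x u) ^^ q (bxor (bxor x u) w)) ^^ (q (bxor (bxor x u) v) ^^ q (bxor (bxor (bxor x u) v) w)))) = false)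
    (hB0 : ∀ j m : Fin 7, ((q zeroVec ^^ q (fun l => decide (l = m))) ^^
      (q (fun l => decide (l = j)) ^^ q (bxor (fun l => decide (l = j)) (fun l => decide (l = m))))) = false)
    (hne : ∃ s, q s = true) : 64 ≤ #(univ.filter fun s : Fin 7 → Bool => q s = true) := by
  classical
  set B : (Fin 7 → Bool) → (Fin 7 → Bool) → Bool :=
    fun v w => (q zeroVec ^^ q (bxor zeroVec w)) ^^ (q (bxor zeroVec v) ^^ q (bxor (bxor zeroVec v) w)) with hBdef
  have hB' : ∀ v w y, ((q y ^^ q (bxor y w)) ^^ (q (bxor y v) ^^ q (bxor (bxor y v) w))) = B v w :=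
    fun v w y => tl2_second_const q h3 v w y
  obtain ⟨hsymm, -, -, htr⟩ := tcb_form_basic q B hB'
  -- the form vanishes identically: rows of unit vectors first, then all rows
  have hunit : ∀ (j : Fin 7) (y : Fin 7 → Bool),
      ((q zeroVec ^^ q y) ^^ (q (fun l => decide (l = j)) ^^ q (bxor (fun l => decide (l = j)) y))) = false :=
    fun j => tq0_form_row_zero q h3 (fun l => decide (l = j)) (fun m => hB0 j m)
  have hrow : ∀ x y : Fin 7 → Bool, B x y = false := by
    intro x
    have hx := tq0_form_row_zero q h3 x (fun m => by
      have e := hunit m x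
      rw [bxor_comm] at e
      revert e
      cases q zeroVec <;> cases q x <;> cases q (fun l => decide (l = m)) <;> cases q (bxor x fun l => decide (l = m)) <;> decide)
    intro y
    have e := hx y
    simp only [hBdef, zeroVec_bxor]
    exact e
  obtain ⟨s, hs⟩ := hne
  by_cases hc : ∃ t, q t ≠ q zeroVec
  · obtain ⟨t, ht⟩ := hc
    have hbal := (tcb_balanced_iff q B hB').mpr ⟨t, fun y => hrow t y, ht⟩
    norm_num at hbal
    omega
  · push Not at hc
    have h0v : q zeroVec = true := by rw [← hc s]; exact hs
    have hall : (univ.filter fun s : Fin 7 → Bool => q s = true) = univ := by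
      apply eq_univ_of_forall; intro s'; rw [mem_filter]; exact ⟨mem_univ _, by rw [hc s', h0v]⟩
    rw [hall, card_univ, Fintype.card_fun, Fintype.card_bool, Fintype.card_fin]
    norm_num

/-- **Light nonzero forms have rank `2`: the radical has `32` elements.**  If the form of `q` is `1` at some pair and `#q < 48`, then
`#{r : Δ_{r,y} q(0) = 0 ∀ y} = 32`. [cite: MacWilliamsSloane1977, Ch. 15 §2] -/
theorem tq0_rad32 (q : (Fin 7 → Bool) → Bool)
    (h3 : ∀ u v w x : Fin 7 → Bool, (((q x ^^ q (bxor x w)) ^^ (q (bxor x v) ^^ q (bxor (bxor x v) w))) ^^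
      ((q (bxor x u) ^^ q (bxor (bxor x u) w)) ^^ (q (bxor (bxor x u) v) ^^ q (bxor (bxor (bxor x u) v) w)))) = false)
    (x x' : Fin 7 → Bool) (hx : ((q zeroVec ^^ q (bxor zeroVec x')) ^^ (q (bxor zeroVec x) ^^ q (bxor (bxor zeroVec x) x'))) = true)
    (hlt : #(univ.filter fun s : Fin 7 → Bool => q s = true) < 48) :
    #(univ.filter fun r : Fin 7 → Bool => ∀ y,
      ((q zeroVec ^^ q (bxor zeroVec y)) ^^ (q (bxor zeroVec r) ^^ q (bxor (bxor zeroVec r) y))) = false) = 32 := by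
  classical
  set B : (Fin 7 → Bool) → (Fin 7 → Bool) → Bool :=
    fun v w => (q zeroVec ^^ q (bxor zeroVec w)) ^^ (q (bxor zeroVec v) ^^ q (bxor (bxor zeroVec v) w)) with hBdef
  have hB' : ∀ v w y, ((q y ^^ q (bxor y w)) ^^ (q (bxor y v) ^^ q (bxor (bxor y v) w))) = B v w :=
    fun v w y => tl2_second_const q h3 v w y
  obtain ⟨hsymm, hadd, halt, -⟩ := tcb_form_basic q B hB'
  have hxB : B x x' = true := hx
  obtain ⟨h, b, c, hbc, hbc', hbb, hcc, hmax⟩ := tcs_frame_exists B hsymm halt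
  obtain ⟨hle, htri⟩ := tce_dickson_exact q B hB' h b c hbc hbc' hbb hmax
  have hpos : 1 ≤ h := by
    rcases Nat.eq_zero_or_pos h with h0 | hpos
    · subst h0
      have := tce_form_zero_of_frame_zero B b c hmax x x'
      rw [hxB] at this
      exact absurd this (by decide)
    · exact hpos
  have hh1 : h = 1 := by
    by_contra hne
    have hpow : 2 ^ (7 - h) ≤ 32 := by
      calc 2 ^ (7 - h) ≤ 2 ^ 5 := Nat.pow_le_pow_right (by norm_num) (by omega)
        _ = 32 := by norm_num
    generalize hX : 2 ^ (7 - h) = X at htri hpow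
    omega
  subst hh1
  have hrad := (tce_radical_card B hsymm hadd 1 b c hbc hbc' hbb hmax).2
  norm_num at hrad
  exact hrad

end Summit.QuantumAdvantage.QuantumAdvantage.Theorems.CubicForrelation.NearExactIsExact
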